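import Summits.HubbardSuperconductivity.HubbardSuperconductivity.Theses.AposterioriCapRg

/-!
# The order content of the conclusion of `SeededBrokenRegimeBoseFermiPinned`
# (crux [3] of route AposterioriCapRg = stmt-HubbardSuperconductivity-14047; helper, `--supports`)

The conclusion of the crux at a point `(U, μ)`,

  `Concl kStar etaStar U μ := ∃ h₀ > 0, ∃ D : HubbardScaleData, D.MeetsThresholds kStar etaStar ∧`
  `  0 < D.numPatches ∧ 0 < D.meanFieldDensity.fst ∧`
  `  ∀ h ∈ Set.Ioc 0 h₀, ∃ L₀', D.IsCertifiedEnclosure (hubbardScaleReportCT U μ D h) L₀'`,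

is unfolded through `IsCertifiedEnclosure` (one datum for all `L ≥ L₀'`, `β ≥ β₀(L)`), the CT report
(`mem_hubbardScaleReportCTAt_iff`: a Kuratowski upper limit in `M` of `δ`-closures of realised tuples over
admissible frames) and `IsRealisedAtCT` (whose stiffness / compressibility / mean-field-density coordinates ARE
the scale-`Λ₀` response coefficients `scaleStiffnessCT`, `scaleCompressibilityCT`, `scaleMeanFieldDensityCT` of
the model) into what it demands of the MODEL, with no datum left in the statement:

* `stub_conclOrderContent` (registered stub of the crux's line registry) — there are positive constants `m, ρ, κ₀` (`ρ κ₀ ≥ (kStar Λ₀)²`,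
  `ρ ≥ kStar Λ₀ v` for some `v > 0`) and a scale `Λ₀ > 0` such that for EVERY seed `h ∈ (0, h₀]`, for all
  large `L`, then all large `β`, for every `δ > 0`, frequently in `M`, SOME admissible frame `K` has
  `m - δ < scaleMeanFieldDensityCT L M β U μ h K Λ₀`, `ρ - δ < scaleStiffnessCT …`, `κ₀ - δ < scaleCompressibilityCT …`:
  `h`-UNIFORM strictly positive lower bounds on the mean-field anomalous `B₁g` density, the phase stiffness and
  the pair compressibility of the seeded Hubbard torus at scale `Λ₀`, in the limit order `M → ∞`, `β → ∞`,
  `L → ∞` BEFORE `h → 0⁺` — i.e. `U(1)`-breaking-type (long-range-order-type) positivity of the model's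
  scale-`Λ₀` responses at `U`, `μ`.  This is the dual of the standing disprover's
  `noSmallRemainderData_of_tupleFloor` / `reportFloor_of_realisedFloor` (Cruxes/…/Disproof.lean §9), which
  extract the remainder coordinate the same way.
* `responsesUniformlyPositive_of_seededBrokenRegimeBoseFermiPinned` — the crux-level corollary: `[3]` implies,
  for every pair of positive thresholds, a tolerance `Θ` such that at every `v3`-certified point of the box
  (density clause included) the above `h`-uniform positivity holds with `ρ κ₀ ≥ (kStar Λ₀)²`.

Nothing here is specific to the remainder clause or to the kept sector of the report (so it is invariant under
the restatements D1‴ / (α) on record): whatever the report's kept sector, a proof of `[3]` must establish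
`h`-uniform positivity of `scaleMeanFieldDensityCT` (and of `ρ_s`, `κ`) for the interacting model at
`U ∈ [2, 3]` below a certified scale.  No model content is proved here (pure unfolding); sources: the tree's
definitions `HubbardScaleData.IsCertifiedEnclosure`, `hubbardScaleReportCT`, `IsRealisedAtCT` (a-posteriori
format, Figueras–Haro–Luque 2016 Thm. 2.5; Koma–Tasaki 1994 §1 for the sourced order parameter `m₀`).
-/

set_option linter.dupNamespace false -- `Summit.<S>.<S>` doubles the summit name (tree convention)

namespace Summit.HubbardSuperconductivity.HubbardSuperconductivity.Theorems.AposterioriCapRgSeededBrokenRegimeBoseFermiPinned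

open Literature.MathematicalPhysics.QuantumLattice NonemptyInterval Filter
open Summit.HubbardSuperconductivity.HubbardSuperconductivity.Theses.AposterioriCapRg

/-- **The order content of `Concl`.**  If the conclusion of `[3]` holds at `(U, μ)` for thresholds
`(kStar, etaStar)` with `0 < kStar`, then the certified datum's lower
end points `m₀.fst`, `ρ_s.fst`, `κ.fst` (all `> 0` by `MeetsThresholds` and `0 < m₀.fst`) are `h`-uniform lower
bounds, up to any `δ > 0` and frequently in `M`, of the model's scale-`Λ₀` responses in some admissible frame —
by unfolding `IsCertifiedEnclosure`, the CT report's upper limit and `IsRealisedAtCT`'s response equalities.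
Pure unfolding; no model content. [folklore] -/
theorem stub_conclOrderContent :
    ∀ (kStar etaStar : ℚ), 0 < kStar → ∀ (U μ : ℝ),
      (∃ h₀ : ℝ, 0 < h₀ ∧ ∃ D : HubbardScaleData, D.MeetsThresholds kStar etaStar ∧ 0 < D.numPatches ∧
        0 < D.meanFieldDensity.fst ∧
        ∀ h ∈ Set.Ioc (0:ℝ) h₀, ∃ L₀' : ℕ, D.IsCertifiedEnclosure (hubbardScaleReportCT U μ D h) L₀') →
      ∃ (h₀ Λ₀ m ρ κ₀ v : ℝ), 0 < h₀ ∧ 0 < Λ₀ ∧ 0 < m ∧ 0 < ρ ∧ 0 < κ₀ ∧ 0 < v ∧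
        ((kStar : ℝ) * Λ₀) ^ 2 ≤ ρ * κ₀ ∧ (kStar : ℝ) * Λ₀ * v ≤ ρ ∧
        ∃ (Np : ℕ) (nodal : Finset (Fin Np)), ∀ h ∈ Set.Ioc (0:ℝ) h₀, ∃ L₀' : ℕ, ∀ L : ℕ, L₀' ≤ L → ∀ [NeZero L],
          ∃ β₀ : ℝ, ∀ β : ℝ, β₀ ≤ β → ∀ δ : ℝ, 0 < δ → ∃ᶠ M in Filter.atTop, ∃ K : TrigPolyC4v, IsAdmissibleFrame K ∧
            m - δ < scaleMeanFieldDensityCT L M β U μ h K Λ₀ ∧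
            ρ - δ < scaleStiffnessCT L M β U μ h K Λ₀ ∧
            κ₀ - δ < scaleCompressibilityCT L M β U μ h K Λ₀ ∧
            ∃ p : HubbardScaleData.Parameters Np, IsRealisedAtCT L M β U μ h K Λ₀ Np nodal p ∧
              m - δ < p.meanFieldDensity ∧ ρ - δ < p.stiffness ∧ κ₀ - δ < p.compressibility := by
  intro kStar etaStar hk U μ hC
  obtain ⟨h₀, hh₀, D, hmeets, -, hm, hcert⟩ := hC
  obtain ⟨hκ, hvF, -, h1, -, h3, -, -⟩ := (hmeets : D.MeetsThresholdsWith 10 kStar etaStar)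
  have hΛ : (0:ℝ) < D.scale := D.cast_scale_pos
  have hk' : (0:ℝ) < kStar := by exact_mod_cast hk
  have hvFs : 0 < D.fermiVelocity.snd := hvF.trans_le D.fermiVelocity.fst_le_snd
  have hvFs' : (0:ℝ) < D.fermiVelocity.snd := by exact_mod_cast hvFs
  have h1' : (kStar : ℝ) * D.scale * D.fermiVelocity.snd ≤ D.stiffness.fst := by exact_mod_cast h1
  have h3' : ((kStar : ℝ) * D.scale) ^ 2 ≤ (D.stiffness.fst : ℝ) * D.compressibility.fst := by
    exact_mod_cast h3
  have hρ : (0:ℝ) < D.stiffness.fst := lt_of_lt_of_le (by positivity) h1'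
  have hκ' : (0:ℝ) < D.compressibility.fst := by exact_mod_cast hκ
  have hm' : (0:ℝ) < D.meanFieldDensity.fst := by exact_mod_cast hm
  refine ⟨h₀, D.scale, D.meanFieldDensity.fst, D.stiffness.fst, D.compressibility.fst, D.fermiVelocity.snd,
    hh₀, hΛ, hm', hρ, hκ', hvFs', h3', h1', D.numPatches, D.nodal, fun h hh => ?_⟩
  obtain ⟨L₀', hL₀'⟩ := hcert h hh
  refine ⟨L₀', fun L hL _ => ?_⟩
  obtain ⟨β₀, hβ₀⟩ := hL₀' L hL
  refine ⟨β₀, fun β hβ δ hδ => ?_⟩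
  obtain ⟨p, hpR, henc⟩ := hβ₀ β hβ
  rw [hubbardScaleReportCT_eq, mem_hubbardScaleReportCTAt_iff] at hpR
  obtain ⟨-, hρp, hκp, -, -, -, hmp⟩ := henc
  rw [NonemptyInterval.mem_ratCast_iff] at hρp hκp hmp
  refine (hpR δ hδ).mono fun M ⟨K, hK, p', hp', hclose⟩ => ⟨K, hK, ?_⟩
  obtain ⟨-, hcs, hcc, -, -, -, hcm⟩ := hclose
  rw [abs_lt] at hcs hcc hcm
  obtain ⟨-, -, -, -, -, -, hρeq, hκeq, hmeq, -⟩ := id hp'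
  refine ⟨?_, ?_, ?_, p', hp', by linarith, by linarith, by linarith⟩
  · rw [← hmeq]; linarith
  · rw [← hρeq]; linarith
  · rw [← hκeq]; linarith

/-- **The order content of the crux `[3]`.**  `SeededBrokenRegimeBoseFermiPinned` implies: for all thresholds
`kStar, etaStar > 0` there is a tolerance `Θ` such that at every point `(U, δ, μ)` of the box carrying the density
clause, every `v3` certificate `symmetricRegimeCertificateT U μ capRgCornerDataT Θ K Λ L₀` forces
the same `h`-uniform `U(1)`-breaking-type positivity of the scale-`Λ₀` mean-field
anomalous density, stiffness and compressibility of the seeded Hubbard torus at `U ∈ [2, 3]`.  (What any proof of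
`[3]`, under any restatement of the report's kept sector, must supply about the model.) [folklore] -/
theorem responsesUniformlyPositive_of_seededBrokenRegimeBoseFermiPinned (hS : SeededBrokenRegimeBoseFermiPinned) :
    ∀ kStar etaStar : ℚ, 0 < kStar → 0 < etaStar → ∃ Θ : SymmetricTolerance, ∀ U ∈ Set.Icc (2:ℝ) 3,
      ∀ δ ∈ Set.Icc (1/5:ℝ) (7/20), ∀ μ : ℝ,
        Filter.Tendsto (fun L : ℕ => ((hubbardTorusWith 2 (L + 1) 1 U μ).groundStateFunctional totalNumber).re /
          ((L + 1 : ℕ) : ℝ) ^ 2) Filter.atTop (nhds (1 - δ)) →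
        ∀ (K : TrigPolyC4v) (Λ : ℝ) (L₀ : ℕ), symmetricRegimeCertificateT U μ capRgCornerDataT Θ K Λ L₀ →
    ∃ (h₀ Λ₀ m ρ κ₀ v : ℝ), 0 < h₀ ∧ 0 < Λ₀ ∧ 0 < m ∧ 0 < ρ ∧ 0 < κ₀ ∧ 0 < v ∧
      ((kStar : ℝ) * Λ₀) ^ 2 ≤ ρ * κ₀ ∧ (kStar : ℝ) * Λ₀ * v ≤ ρ ∧
      ∃ (Np : ℕ) (nodal : Finset (Fin Np)), ∀ h ∈ Set.Ioc (0:ℝ) h₀, ∃ L₀' : ℕ, ∀ L : ℕ, L₀' ≤ L → ∀ [NeZero L],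
        ∃ β₀ : ℝ, ∀ β : ℝ, β₀ ≤ β → ∀ δ : ℝ, 0 < δ → ∃ᶠ M in atTop, ∃ K : TrigPolyC4v, IsAdmissibleFrame K ∧
          m - δ < scaleMeanFieldDensityCT L M β U μ h K Λ₀ ∧
          ρ - δ < scaleStiffnessCT L M β U μ h K Λ₀ ∧
          κ₀ - δ < scaleCompressibilityCT L M β U μ h K Λ₀ ∧
          (∃ p : HubbardScaleData.Parameters Np, IsRealisedAtCT L M β U μ h K Λ₀ Np nodal p ∧
            m - δ < p.meanFieldDensity ∧ ρ - δ < p.stiffness ∧ κ₀ - δ < p.compressibility) := by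
  intro kStar etaStar hk he
  obtain ⟨Θ, hΘ⟩ := hS kStar etaStar hk he
  exact ⟨Θ, fun U hU δ hδ μ hd K Λ L₀ hcert => stub_conclOrderContent kStar etaStar hk U μ (hΘ U hU δ hδ μ hd K Λ L₀ hcert)⟩

end Summit.HubbardSuperconductivity.HubbardSuperconductivity.Theorems.AposterioriCapRgSeededBrokenRegimeBoseFermiPinned
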